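import Literature.AnabelianGeometry.EtaleTheta.FrobenioidThetaBiKummer
import Literature.AnabelianGeometry.EtaleTheta.Discharge.Sec5DegenerateDatum

/-!
# [EtTh] §5: the kernel status of the schema `ApplicabilityOfGeneralTheory` (Proposition 5.1 as typed; F-2496)

Mochizuki, *The étale theta function and its Frobenioid-theoretic manifestations*, Publ. RIMS **45** (2009),
Prop. 5.1 p. 323 (PDF p. 97) [cite: MochizukiEtTh2009, Prop 5.1 p.323 (PDF p.97)].  abc-iut cell, block C (W6 cone
prover abc-iut-w6-d062), node EtTh:Prop5.1 / FACT-LIST row F-2496 (class «structure of stub `Prop`s»); PROOF-ONLY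
companion (no `def`) of abc-iut-L2-t4's `FrobenioidThetaBiKummer.lean` (`TemperedVocabStub`,
`ApplicabilityOfGeneralTheory`) and abc-iut-f-115's `Discharge/Sec5DegenerateDatum.lean` (`Sec5Toy.datum`, a
closed-term degenerate inhabitant of the §5 data record over the one-object base).  Nothing landed is edited or
restated.

* `applicabilityOfGeneralTheory_iff` — the typed Prop. 5.1 is literally the conjunction of the ten clauses of the
  vocabulary stub (bookkeeping for consumers);
* `not_applicabilityOfGeneralTheory_datum_false`, **`not_forall_applicabilityOfGeneralTheory`** — the UNIVERSAL
  CLOSURE of the schema `ApplicabilityOfGeneralTheory 𝔉 V Ψ` over (§5 data `𝔉`, vocabulary stub `V`,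
  self-equivalence `Ψ`) is FALSE: nothing constrains the fields of `TemperedVocabStub`, so at `Sec5Toy.datum` the stub
  whose clauses are `False` fails; F-2496 is therefore consumable AT NAMED INSTANCES ONLY (plan R5), the instance
  forms of record being abc-iut-L2-t9's `TemperedFrobenioid.applicability_of_model` /
  `Example39Data.applicability_of_example39` and `Example39Data.applicability_of_example39_treeMonoidVocab`
  (`Discharge/Sec5Prop51Example39NonDilating.lean`: Prop. 5.1 for the Example 3.9 (iv) Frobenioid reduced to six
  named inputs);
* `applicabilityOfGeneralTheory_datum_true` — at the same datum the all-`True` stub satisfies it (consistency).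

HONEST FRAMING: one counterexample to the ∀-closure of a typed PREDICATE at a degenerate datum that is NOT the
Frobenioid of a curve, and bookkeeping; it says nothing about [EtTh]'s Proposition 5.1 for the genuine data; [EtTh] is
refereed; nothing here bears on [IUTchIII] Cor. 3.12 — no side is taken; typed ≠ proved.
-/

namespace Literature.AnabelianGeometry.EtaleTheta

open CategoryTheory Literature.AlgebraicGeometry.Frobenioids

namespace FrobenioidThetaBiKummer

section Schema

universe w v₁ v₂ u₁ u₂

variable {C : Type u₁} [Category.{v₁} C] {D : Type u₂} [Category.{v₂} D]

/-- Bookkeeping: abc-iut-L2-t4's typed Proposition 5.1 `ApplicabilityOfGeneralTheory 𝔉 V Ψ` is, literally, the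
conjunction of the ten clauses of the vocabulary stub `V` ("tempered", "rationally standard", "slim base", "monoid
type `ℤ`", "perfect", "perf-factorial", "non-dilating", "cuspidally pure", hypotheses of Cor. 3.8, of Thm. 4.4).
[cite: MochizukiEtTh2009, Prop 5.1 p.323 (PDF p.97)] -/
theorem applicabilityOfGeneralTheory_iff (𝔉 : ThetaFrobenioid.{w} C D) (V : TemperedVocabStub 𝔉) (Ψ : C ≌ C) :
    ApplicabilityOfGeneralTheory 𝔉 V Ψ ↔
      V.IsTemperedFrobenioid ∧ V.IsRationallyStandard ∧ V.IsSlimBase ∧ V.IsMonoidTypeZ ∧ V.IsPerfect ∧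
        V.IsPerfFactorial ∧ V.IsNonDilating ∧ V.IsCuspidallyPure ∧ V.HypothesesCor38 Ψ ∧ V.HypothesesThm44 Ψ :=
  ⟨fun h => ⟨h.tempered, h.rationallyStandard, h.slimBase, h.monoidTypeZ, h.perfect, h.perfFactorial, h.nonDilating,
      h.cuspidallyPure, h.hypothesesCor38, h.hypothesesThm44⟩,
    fun h => ⟨h.1, h.2.1, h.2.2.1, h.2.2.2.1, h.2.2.2.2.1, h.2.2.2.2.2.1, h.2.2.2.2.2.2.1, h.2.2.2.2.2.2.2.1,
      h.2.2.2.2.2.2.2.2.1, h.2.2.2.2.2.2.2.2.2⟩⟩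

end Schema

/-- **F-2496 at abc-iut-f-115's degenerate §5 datum**: with the vocabulary stub all of whose clauses are `False`
(nothing constrains the fields of `TemperedVocabStub`), the typed Proposition 5.1 FAILS for `Sec5Toy.datum` and the
identity self-equivalence.  [cite: MochizukiEtTh2009, Prop 5.1 p.323 (PDF p.97)] -/
theorem not_applicabilityOfGeneralTheory_datum_false :
    ¬ ApplicabilityOfGeneralTheory Sec5Toy.datum
        { IsTemperedFrobenioid := False, IsRationallyStandard := False, IsSlimBase := False,
          IsMonoidTypeZ := False, IsPerfect := False, IsPerfFactorial := False, IsNonDilating := False,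
          IsCuspidallyPure := False, HypothesesCor38 := fun _ => False, HypothesesThm44 := fun _ => False }
        (CategoryTheory.Equivalence.refl : Discrete PUnit.{1} ≌ Discrete PUnit.{1}) :=
  fun h => h.tempered

/-- **F-2496: the universal closure of the schema `ApplicabilityOfGeneralTheory` is FALSE** (already over §5 data at
the one-object base category): Proposition 5.1 as typed is a conjunction of FREE vocabulary predicates attached to the
data, so it is consumable AT NAMED INSTANCES ONLY (plan R5) — the instance forms of record are abc-iut-L2-t9's
`TemperedFrobenioid.applicability_of_model` / `Example39Data.applicability_of_example39` and
`Example39Data.applicability_of_example39_treeMonoidVocab` (Prop. 5.1 for the Example 3.9 (iv) Frobenioid, reduced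
to six named inputs).  [cite: MochizukiEtTh2009, Prop 5.1 p.323 (PDF p.97)] -/
theorem not_forall_applicabilityOfGeneralTheory :
    ¬ ∀ (𝔉 : ThetaFrobenioid.{0} (Discrete PUnit.{1}) (Discrete PUnit.{1})) (V : TemperedVocabStub 𝔉)
        (Ψ : Discrete PUnit.{1} ≌ Discrete PUnit.{1}), ApplicabilityOfGeneralTheory 𝔉 V Ψ :=
  fun h => not_applicabilityOfGeneralTheory_datum_false (h Sec5Toy.datum _ _)

/-- … while at the SAME datum the vocabulary stub all of whose clauses are `True` satisfies the typed Proposition 5.1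
(the schema is consistent at the degenerate datum; no discharge over it is vacuous for want of a vocabulary).
[cite: MochizukiEtTh2009, Prop 5.1 p.323 (PDF p.97)] -/
theorem applicabilityOfGeneralTheory_datum_true :
    ApplicabilityOfGeneralTheory Sec5Toy.datum
        { IsTemperedFrobenioid := True, IsRationallyStandard := True, IsSlimBase := True,
          IsMonoidTypeZ := True, IsPerfect := True, IsPerfFactorial := True, IsNonDilating := True,
          IsCuspidallyPure := True, HypothesesCor38 := fun _ => True, HypothesesThm44 := fun _ => True }
        (CategoryTheory.Equivalence.refl : Discrete PUnit.{1} ≌ Discrete PUnit.{1}) :=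
  ⟨trivial, trivial, trivial, trivial, trivial, trivial, trivial, trivial, trivial, trivial⟩

end FrobenioidThetaBiKummer

end Literature.AnabelianGeometry.EtaleTheta
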